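import Summits.QuantumFields.YangMills.Theorems.BalabanUVNodesK0Stub1FlatAveragingDictionaryLevels
import Summits.QuantumFields.YangMills.Theorems.UnitScaleTiltProp8ChartKernelTube
import Literature.MathematicalPhysics.QuantumFieldTheory.Balaban1983to89.B6AgreeQaQV1Chart

/-!
# K0⁷ STUB 1 (`stub_prop8StepCoP13`), sub-target S4a — **THE COLUMN LETTER OF THE MULTI-LEVEL GAUGE MAP `T`** (file 1∕2 of the k-UNIFORM SUP LETTER
# of the corrected current `W′ = W + RᵀW`): a fine bond is read by the hierarchical comb functional `Λ_j` of at most THREE touched blocks, with total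
# coefficient mass `≤ 6(d+2)L` — NO `L^k`, NO `N`

Cell `pub-ymgap`, width seat `pub-ymgap-k0-s1-w1` g6 (CLAIM-1, bus «K0S1W1-G6-STARTED»; the located on-path S4a item (t3) of HOME `HANDOFF.md` § g5: the (98)-slot
letter of the corrected current).  `--kind proof --supports stmt-QuantumFields-20541 --as helper`; count-neutral.  File 2∕2 = `…K0Stub1CorrectedCurrentLetter`
(Frobenius∕operator-norm duality and the letter `‖RᵀW‖_∞ ≤ 12·d·(d+2)·L·‖W‖_∞`).
[15] = [Balaban1985Variational]; [B5] = [Balaban1984PropagatorsI]; [B6] = [Balaban1984PropagatorsII]; [B7] = [Balaban1985Averaging]; [I] = [Balaban1987RG1].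

WHY.  p617458 (`…K0Stub1FlatAveragingDictionaryLevels`) builds the gauge map `T` carrying print's multi-level kernel into the record's: `(TZ)(x) = Λ_jZ(y)` at the centre
`x = embIter j y` of a touched `j`-site, `0` elsewhere, with the sup letter `(d+2)L^{k+1}·sup‖Z‖` — NOT uniform in the number of levels `k`.  p618723
(`…K0Stub1CorrectedCurrentJunction`) then corrects the current of [15] (127)–(128) by the skew Frobenius transpose `Rᵀ` of `∂∘T`: `W′ = W + RᵀW`.  For `W′` to be
admissible in the (98)∕(165) sup slots of [15] one needs `‖RᵀW‖_∞ ≤ C·‖W‖_∞` with `C` INDEPENDENT of `k`; by duality this is a bound on the `ℓ¹`-COLUMNS of `T`: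
for a field `Z` supported on ONE fine bond `b′`, `Σ_x ‖(TZ)(x)‖ ≤ C′·‖Z(b′)‖`.  THIS FILE proves the column letter with `C′ = 6(d+2)L`:
(i) SCALARS: on `Z = f•E` (`f` real) the straight averages `Q_i`, the comb mean `λ̄` and hence `Λ_j` act by REAL coefficients, `Λ_j(f•E)(y) = r•E`, and for
`0 ≤ f`, `Σf ≤ 1` the coefficient obeys `|r| ≤ (d+2)L·Σ_{i<j} Lⁱ·(L^{−d})ⁱ ≤ 2(d+2)L` (column mass `Σ_c Q_i(c,b′) = L^{−id}` of [B5] (1.18), `B8Prop3MultiLevelTorus.sum_bondAvgIter`;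
staircases of `≤ (d+2)L` steps; `d ≥ 2`);
(ii) LOCALITY: `Λ_jZ(y)` reads `Z` only on fine bonds inside `Bʲ(y)` (block locality of `Q_i`, `B6AgreeQaQV1Chart.bondAvgIter_eq_zero_of_local`, and of `λ̄`,
UST `ChartHInv.combMean_congr_stairs` + `T4Continuum.blockOf_ends_of_mem_stairWalk`);
(iii) THE BOUNDARY LEMMA under the collar property: an `Ω_i`-site with a lattice neighbour outside `Ω_i` is a `Λ_i`-site (downward induction from the top level: a deep
such site would have its block and the neighbour's block forming a `Λ_{i+1}`-bond, whose collar puts the neighbour back into `Ω_i`) — hence the touched `j`-blocks over a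
fine site of territory `j₀` have `j ∈ {j₀ − 1, j₀, j₀ + 1}` (p616754 `depth_cases_of_touched`: its inner-crossing case forces `j₀ = j + 1`): AT MOST THREE LEVELS;
(iv) for every `T` with p617458's DICHOTOMY clause the column of `T` at `b′` is `c(x)•Z(b′)` with `Σ_x |c(x)| ≤ 3·2(d+2)L`.

WHAT IS PROVED (sorry-free; no definition; axioms standard; `M = M_N(ℂ)`, operator norm `Matrix.Norms.L2Operator`).
* §1 `walkSum_smul_const`, `abs_walkSum_le`, `combMean_smul_const`, `exists_combMean_smul_const` (scalars + `|m| ≤ (d+2)L·s`), ★ `exists_combFamily_smul_const`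
  (`Λ_j(f•E)(y) = r•E`, `|r| ≤ 2(d+2)L` for `0 ≤ f`, `Σf ≤ 1`, `d ≥ 2`), ★ `combFamily_eq_zero_of_vanish` (locality of `Λ_j` in the `j`-block).
* §2 `blockOf_adjacent_of_ne`, ★★ `not_deep_of_adjacent_not_mem` (THE BOUNDARY LEMMA), ★ `level_of_touched` (`j₀ = j ∨ j₀ + 1 = j ∨ j + 1 = j₀`).
* §3 ★★★ `exists_column_of_dichotomy` — for every map `T` (fine bond fields → fine gauge functions) with the dichotomy clause of p617458 w.r.t. a nested `D` with the collar and an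
  index reading `I`, and every `Z` supported on one fine bond `b′`: `∃ c : Site → ℝ, (TZ)(x) = c(x)•Z(b′) ∀x ∧ Σ_x |c(x)| ≤ 6(d+2)L`.

HONEST SCOPE.  Finite-dimensional lattice bookkeeping over kernel-checked identities ([B5] (1.11)∕(1.18) column mass, [B7] (62) comb mean, [B6] (2.1)–(2.4) nesting); the only
"estimate" is a walk count and a geometric sum; nothing of Bałaban's analysis asserted; the SOCKET `h127rec` is not produced; `stub_prop8StepCoP13` ∕ K0⁷ NOT closed; N07 NOT
discharged; counts unmoved (28∕28 · 5∕27); one finite 𝕋⁴ programme at fixed ε — R4 closes the conditional finite-𝕋⁴ rung `BalabanLadder.UV` only, never the summit; the YM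
mass gap (Clay) is NOT proved by any of this; nothing continuum ∕ ℝ⁴ ∕ OS.  No `sorry`, no `def`, no `instance`, no `notation`.

References: [B5] (1.11) p.19, (1.18) p.20; [B6] (2.1)–(2.4) p.224, (2.20) p.226; [B7] (11) p.18, (62) p.28; [15] (44)–(47) p.285, (98) p.292, (127)–(128) p.297, (165) p.303;
[I] (0.1)–(0.4) pp.251–253.
-/

set_option autoImplicit false
noncomputable section
open scoped BigOperators Matrix Matrix.Norms.L2Operator

namespace Summit.QuantumFields.YangMills.Theorems.K0Stub1CombColumnLetter

open Literature.MathematicalPhysics.QuantumFieldTheory.Balaban1983to89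
open LatticeFieldCalculus (bondAvgIter)
open BlockAveragingEMLLinearised (combMean combMean_def walkSum walkSum_nil walkSum_cons length_walk_stairWord_le)
open B5Eq118OneStroke (iterBlockOf iterBlockOf_zero iterBlockOf_succ)
open B15DeterminingSets (embIter)
open B6SectADomainsV1 (Domains)
open Summit.QuantumFields.YangMills.Theorems.ChartHInv (exists_combFamily combMean_congr_stairs combMean_zero)
open Summit.QuantumFields.YangMills.Theorems.K0Stub1TouchedCentresOfDomains (depth_cases_of_touched inOm_of_le_depth)

variable {P : Params} {N : ℕ}

/-! ## §1  Real coefficients and block locality of the hierarchical comb functional -/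

section Scalars

/-- The signed walk sum of `c ↦ g(c)•E` (`g` real) is `(Σ± g)•E`. [cite: Balaban1984PropagatorsI, (1.8) p.19] -/
theorem walkSum_smul_const {j : ℕ} (g : PBond P j → ℝ) (E : Matrix (Fin N) (Fin N) ℂ) :
    ∀ γ : List (T4Continuum.LStep P j), walkSum (fun c => g c • E) γ = walkSum g γ • E
  | [] => by rw [walkSum_nil, walkSum_nil, zero_smul]
  | s :: γ => by
    rw [walkSum_cons, walkSum_cons, walkSum_smul_const g E γ, add_smul]
    split_ifs
    · rfl
    · rw [neg_smul]

/-- `|Σ± g| ≤ |Γ|·s` along a walk `Γ` if `|g(c)| ≤ s` on every bond. [folklore] -/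
theorem abs_walkSum_le {j : ℕ} (g : PBond P j → ℝ) {s : ℝ} (hg : ∀ c, |g c| ≤ s) :
    ∀ γ : List (T4Continuum.LStep P j), |walkSum g γ| ≤ γ.length * s
  | [] => by simp [walkSum_nil]
  | st :: γ => by
    rw [walkSum_cons, List.length_cons]
    have ih := abs_walkSum_le g hg γ
    have hs : |(if st.fwd then g st.bond else -g st.bond)| ≤ s := by
      split_ifs
      · exact hg _
      · rw [abs_neg]; exact hg _
    calc |(if st.fwd then g st.bond else -g st.bond) + walkSum g γ|
        ≤ |(if st.fwd then g st.bond else -g st.bond)| + |walkSum g γ| := abs_add_le _ _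
      _ ≤ s + γ.length * s := add_le_add hs ih
      _ = ((γ.length + 1 : ℕ) : ℝ) * s := by push_cast; ring

/-- **THE COMB MEAN ACTS BY REAL COEFFICIENTS**: `λ̄(g•E)(y) = (|I|⁻¹·Σ_{(n,σ,σ′)∈I} Σ±_{Γ^σ_{y→y+n}} g)•E`. [cite: Balaban1985Averaging, (62) p.28] -/
theorem combMean_smul_const {j : ℕ} (g : PBond P j → ℝ) (E : Matrix (Fin N) (Fin N) ℂ) (y : Site P (j + 1)) :
    combMean (fun c => g c • E) y =
      (((Fintype.card (BlockAveraging.Idx P) : ℝ))⁻¹ *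
        ∑ i : BlockAveraging.Idx P, walkSum g (T4Continuum.walk (emb y) (T4Continuum.stairWord i.2.1 (BlockAveraging.off i.1)))) • E := by
  rw [combMean_def]
  simp only [walkSum_smul_const]
  rw [← Finset.sum_smul, mul_smul, ← Complex.coe_smul (((Fintype.card (BlockAveraging.Idx P) : ℝ))⁻¹), Complex.ofReal_inv,
    Complex.ofReal_natCast]

/-- … with the letter: `|g(c)| ≤ s` on every `j`-bond ⇒ `λ̄(g•E)(y) = m•E` with `|m| ≤ (d+2)L·s` (staircases of at most `(d+2)L` steps,
`length_walk_stairWord_le`). [cite: Balaban1985Averaging, (62) p.28; Balaban1987RG1, (0.3) p.252] -/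
theorem exists_combMean_smul_const {j : ℕ} (g : PBond P j → ℝ) (E : Matrix (Fin N) (Fin N) ℂ) (y : Site P (j + 1)) {s : ℝ} (hs : 0 ≤ s)
    (hg : ∀ c, |g c| ≤ s) :
    ∃ m : ℝ, combMean (fun c => g c • E) y = m • E ∧ |m| ≤ (((P.d + 2) * P.L : ℕ) : ℝ) * s := by
  refine ⟨_, combMean_smul_const g E y, ?_⟩
  have hc : (0 : ℝ) < Fintype.card (BlockAveraging.Idx P) := Nat.cast_pos.mpr Fintype.card_pos
  have hterm : ∀ i : BlockAveraging.Idx P,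
      |walkSum g (T4Continuum.walk (emb y) (T4Continuum.stairWord i.2.1 (BlockAveraging.off i.1)))| ≤ (((P.d + 2) * P.L : ℕ) : ℝ) * s := by
    intro i
    refine (abs_walkSum_le g hg _).trans ?_
    have hl := length_walk_stairWord_le (emb y) i.2.1 i.1
    exact mul_le_mul_of_nonneg_right (by exact_mod_cast hl) hs
  have hsum : ∑ i : BlockAveraging.Idx P, |walkSum g (T4Continuum.walk (emb y) (T4Continuum.stairWord i.2.1 (BlockAveraging.off i.1)))|
      ≤ ∑ _i : BlockAveraging.Idx P, (((P.d + 2) * P.L : ℕ) : ℝ) * s := Finset.sum_le_sum fun i _ => hterm i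
  rw [Finset.sum_const, Finset.card_univ, nsmul_eq_mul] at hsum
  rw [abs_mul, abs_inv, abs_of_pos hc, inv_mul_le_iff₀ hc]
  exact (Finset.abs_sum_le_sum_abs _ _).trans hsum

variable (Λ : (i : ℕ) → (PBond P 0 → Matrix (Fin N) (Fin N) ℂ) → Site P i → Matrix (Fin N) (Fin N) ℂ)
  (hΛ0 : ∀ Y y, Λ 0 Y y = 0)
  (hΛs : ∀ (i : ℕ) (Y : PBond P 0 → Matrix (Fin N) (Fin N) ℂ) (y : Site P (i + 1)),
    Λ (i + 1) Y y = (P.L ^ i : ℕ) • combMean (bondAvgIter i Y) y + Λ i Y (emb y))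

/-- `L∕L^d ≤ 1∕2` for `d ≥ 2` (`L ≥ 2`): the ratio of the geometric series of the level coefficients. [folklore] -/
theorem ratio_le_half (hd : 2 ≤ P.d) : (P.L : ℝ) * ((P.L : ℝ) ^ P.d)⁻¹ ≤ 1 / 2 := by
  have hL2 : (2 : ℝ) ≤ P.L := by exact_mod_cast P.hL.2
  have hL0 : (0 : ℝ) < P.L := by linarith
  have hpow : (P.L : ℝ) * (2 : ℝ) ≤ (P.L : ℝ) ^ P.d := by
    calc (P.L : ℝ) * 2 ≤ (P.L : ℝ) * P.L := mul_le_mul_of_nonneg_left hL2 hL0.le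
      _ = (P.L : ℝ) ^ 2 := by ring
      _ ≤ (P.L : ℝ) ^ P.d := pow_le_pow_right₀ (by linarith) hd
  have hpd : (0 : ℝ) < (P.L : ℝ) ^ P.d := by positivity
  rw [mul_inv_le_iff₀ hpd]
  linarith

include hΛ0 hΛs in
/-- ★ **THE HIERARCHICAL COMB FUNCTIONAL ACTS BY REAL COEFFICIENTS, WITH A LEVEL-UNIFORM LETTER ON A UNIT COLUMN**: for a real `f ≥ 0` with `Σ_b f(b) ≤ 1`
(e.g. the indicator of one fine bond) and any matrix `E`, `Λ_j(f•E)(y) = r•E` with `|r| ≤ 2(d+2)L·(1 − (L∕L^d)ʲ) ≤ 2(d+2)L` — level `i` contributes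
`Lⁱ·λ̄(Q_if)` with `0 ≤ Q_if ≤ Σ_c Q_if(c) = (L^{−d})ⁱ·Σf` ([B5] (1.18) column mass), `|λ̄| ≤ (d+2)L·max`, and `Σ_i (L∕L^d)ⁱ ≤ 2` for `d ≥ 2`.
[cite: Balaban1985Averaging, (62) p.28; Balaban1984PropagatorsI, (1.11) p.19, (1.18) p.20] -/
theorem exists_combFamily_smul_const (hd : 2 ≤ P.d) (f : PBond P 0 → ℝ) (hf0 : ∀ b, 0 ≤ f b) (hf1 : ∑ b, f b ≤ 1)
    (E : Matrix (Fin N) (Fin N) ℂ) :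
    ∀ (j : ℕ), j ≤ P.m + P.K → ∀ y : Site P j, ∃ r : ℝ, Λ j (fun b => f b • E) y = r • E ∧
      |r| ≤ 2 * (((P.d + 2) * P.L : ℕ) : ℝ) * (1 - ((P.L : ℝ) * ((P.L : ℝ) ^ P.d)⁻¹) ^ j)
  | 0, _, y => ⟨0, by rw [hΛ0, zero_smul], by simp⟩
  | i + 1, hi, y => by
    -- the level-`i` straight average of `f`: non-negative, bounded by its column mass
    have hQf : bondAvgIter i (fun b => f b • E) = fun c => bondAvgIter i f c • E :=
      funext fun c => ChartKernelTube.bondAvgIter_smul_const E i f c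
    have hmass : ∀ c, |bondAvgIter i f c| ≤ (((P.L : ℝ) ^ P.d)⁻¹) ^ i := fun c => by
      rw [abs_of_nonneg (B8Prop3MultiLevelTorus.bondAvgIter_nonneg i hf0 c)]
      refine (Finset.single_le_sum (f := fun c' => bondAvgIter i f c') (fun c' _ => B8Prop3MultiLevelTorus.bondAvgIter_nonneg i hf0 c')
        (Finset.mem_univ c)).trans ?_
      rw [B8Prop3MultiLevelTorus.sum_bondAvgIter i (by omega) f]
      have h0 : (0 : ℝ) ≤ (((P.L : ℝ) ^ P.d)⁻¹) ^ i := by positivity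
      calc (((P.L : ℝ) ^ P.d)⁻¹) ^ i * ∑ b, f b ≤ (((P.L : ℝ) ^ P.d)⁻¹) ^ i * 1 := mul_le_mul_of_nonneg_left hf1 h0
        _ = _ := mul_one _
    obtain ⟨m, hm, hmb⟩ := exists_combMean_smul_const (bondAvgIter i f) E y (by positivity) hmass
    obtain ⟨r, hr, hrb⟩ := exists_combFamily_smul_const hd f hf0 hf1 E i (by omega) (emb y)
    refine ⟨(P.L : ℝ) ^ i * m + r, ?_, ?_⟩
    · rw [hΛs, hQf, hm, hr, ← Nat.cast_smul_eq_nsmul ℝ, smul_smul, ← add_smul, Nat.cast_pow]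
    · -- `|Lⁱ·m + r| ≤ K₁ρⁱ + 2K₁(1 − ρⁱ) = 2K₁ − K₁ρⁱ ≤ 2K₁(1 − ρ^{i+1})` since `2ρ ≤ 1`
      set K₁ : ℝ := (((P.d + 2) * P.L : ℕ) : ℝ) with hK₁
      set ρ : ℝ := (P.L : ℝ) * ((P.L : ℝ) ^ P.d)⁻¹ with hρ
      have hK₁0 : 0 ≤ K₁ := by positivity
      have hρ0 : 0 ≤ ρ := by positivity
      have hρh : ρ ≤ 1 / 2 := ratio_le_half hd
      have hLi : (0 : ℝ) ≤ (P.L : ℝ) ^ i := by positivity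
      have h1 : |(P.L : ℝ) ^ i * m| ≤ K₁ * ρ ^ i := by
        rw [abs_mul, abs_of_nonneg hLi, hρ, mul_pow]
        calc (P.L : ℝ) ^ i * |m| ≤ (P.L : ℝ) ^ i * (K₁ * (((P.L : ℝ) ^ P.d)⁻¹) ^ i) := mul_le_mul_of_nonneg_left hmb hLi
          _ = K₁ * ((P.L : ℝ) ^ i * (((P.L : ℝ) ^ P.d)⁻¹) ^ i) := by ring
      have hρi : 0 ≤ ρ ^ i := pow_nonneg hρ0 i
      have key : K₁ * ρ ^ i + 2 * K₁ * (1 - ρ ^ i) ≤ 2 * K₁ * (1 - ρ ^ (i + 1)) := by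
        rw [pow_succ]
        nlinarith [mul_nonneg hK₁0 hρi]
      calc |(P.L : ℝ) ^ i * m + r| ≤ |(P.L : ℝ) ^ i * m| + |r| := abs_add_le _ _
        _ ≤ K₁ * ρ ^ i + 2 * K₁ * (1 - ρ ^ i) := add_le_add h1 hrb
        _ ≤ 2 * K₁ * (1 - ρ ^ (i + 1)) := key

include hΛ0 hΛs in
/-- … the ROUNDER form `|r| ≤ 2(d+2)L`. [cite: Balaban1985Averaging, (62) p.28; Balaban1984PropagatorsI, (1.18) p.20] -/
theorem exists_combFamily_smul_const' (hd : 2 ≤ P.d) (f : PBond P 0 → ℝ) (hf0 : ∀ b, 0 ≤ f b) (hf1 : ∑ b, f b ≤ 1)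
    (E : Matrix (Fin N) (Fin N) ℂ) {j : ℕ} (hj : j ≤ P.m + P.K) (y : Site P j) :
    ∃ r : ℝ, Λ j (fun b => f b • E) y = r • E ∧ |r| ≤ 2 * (((P.d + 2) * P.L : ℕ) : ℝ) := by
  obtain ⟨r, hr, hrb⟩ := exists_combFamily_smul_const Λ hΛ0 hΛs hd f hf0 hf1 E j hj y
  refine ⟨r, hr, hrb.trans ?_⟩
  have hρ0 : 0 ≤ ((P.L : ℝ) * ((P.L : ℝ) ^ P.d)⁻¹) ^ j := by positivity
  have hK : (0 : ℝ) ≤ 2 * (((P.d + 2) * P.L : ℕ) : ℝ) := by positivity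
  nlinarith

include hΛ0 hΛs in
/-- ★ **BLOCK LOCALITY OF THE HIERARCHICAL COMB FUNCTIONAL**: `Λ_jZ(y)` reads `Z` only on the fine bonds with both end-points in the `j`-block `Bʲ(y)` — if `Z`
vanishes there, `Λ_jZ(y) = 0` (the comb mean reads `Q_iZ` on the staircases inside `B(y′)`, `y′ = emb^{j−1−i}y`, and `Q_iZ(c)` reads `Z` on the fine bonds of the
`i`-blocks `c₋, c₊`). [cite: Balaban1985Averaging, (62) p.28; Balaban1984PropagatorsI, (1.18) p.20; Balaban1987RG1, (0.3) p.252] -/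
theorem combFamily_eq_zero_of_vanish : ∀ (j : ℕ), j ≤ P.m + P.K → ∀ (Z : PBond P 0 → Matrix (Fin N) (Fin N) ℂ) (y : Site P j),
    (∀ b : PBond P 0, iterBlockOf j b.src = y → iterBlockOf j b.tgt = y → Z b = 0) → Λ j Z y = 0
  | 0, _, Z, y, _ => hΛ0 Z y
  | i + 1, hi, Z, y, h => by
    rw [hΛs]
    have hcomb : combMean (bondAvgIter i Z) y = 0 := by
      rw [← combMean_zero (P := P) (n := Fin N) (j := i) y]
      refine combMean_congr_stairs y fun σ r s hs => ?_
      have hb := T4Continuum.blockOf_ends_of_mem_stairWalk hi y r σ s hs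
      refine B6AgreeQaQV1Chart.bondAvgIter_eq_zero_of_local i (by omega) Z s.bond fun b h1 h2 => h b ?_ ?_
      · rw [iterBlockOf_succ]
        rcases h1 with e | e <;> rw [e]
        exacts [hb.1, hb.2]
      · rw [iterBlockOf_succ]
        rcases h2 with e | e <;> rw [e]
        exacts [hb.1, hb.2]
    rw [hcomb, smul_zero, zero_add]
    refine combFamily_eq_zero_of_vanish i (by omega) Z (emb y) fun b h1 h2 => h b ?_ ?_
    · rw [iterBlockOf_succ, h1, Site.blockOf_emb hi]
    · rw [iterBlockOf_succ, h2, Site.blockOf_emb hi]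

end Scalars

/-! ## §2  The boundary lemma under the collar property; the levels of the touched blocks over a fine site -/

section Boundary

variable (D : Domains P)
  (hcollar : ∀ (i : ℕ) (e : PBond P (i + 1)), D.LamBond (i + 1) e → ∀ z : Site P i, (blockOf z = e.src ∨ blockOf z = e.tgt) → z ∈ D.Om i)

/-- Lattice neighbours with DIFFERENT blocks have ADJACENT blocks (in the same direction). [cite: Balaban1987RG1, (0.3) p.252] -/
theorem blockOf_adjacent_of_ne {i : ℕ} (hi : i + 1 ≤ P.m + P.K) {Y Y₁ : Site P i} {μ : Fin P.d}
    (hadj : Y₁ = Y.shift μ ∨ Y = Y₁.shift μ) (hne : blockOf Y₁ ≠ blockOf Y) :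
    blockOf Y₁ = (blockOf Y).shift μ ∨ blockOf Y = (blockOf Y₁).shift μ := by
  rcases hadj with h | h
  · have hb := B10StarCount.blockOf_shift hi Y μ
    rw [← h] at hb
    by_cases hc : (Y μ).val % P.L + 1 = P.L
    · rw [if_pos hc] at hb; exact Or.inl hb
    · rw [if_neg hc] at hb; exact absurd hb hne
  · have hb := B10StarCount.blockOf_shift hi Y₁ μ
    rw [← h] at hb
    by_cases hc : (Y₁ μ).val % P.L + 1 = P.L
    · rw [if_pos hc] at hb; exact Or.inr hb
    · rw [if_neg hc] at hb; exact absurd hb.symm hne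

include hcollar in
/-- ★★ **THE BOUNDARY LEMMA** (collar property): an `Ω_i^{(i)}`-site `Y` with a lattice neighbour `Y₁ ∉ Ω_i^{(i)}` is NOT deep, i.e. it is a `Λ_i`-site.  [Downward
induction from the top level, where nothing is deep: if `Y` were deep, its block `B(Y) ∈ Ω_{i+1}` and the neighbour's block `B(Y₁) ∉ Ω_{i+1}` (nesting) are adjacent,
`B(Y)` is a `Λ_{i+1}`-site by induction, so `[B(Y), B(Y₁)]` is a `Λ_{i+1}`-bond of [B6] (2.3) and the collar puts every `i`-site of the block `B(Y₁)` — in particular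
`Y₁` — into `Ω_i`: contradiction.]  Written `∀ n i, k ≤ i + n → …` for the induction. [cite: Balaban1984PropagatorsII, (2.1)-(2.4) p.224] -/
theorem not_deep_of_adjacent_not_mem : ∀ (n i : ℕ), D.k ≤ i + n → ∀ (Y Y₁ : Site P i) (μ : Fin P.d),
    Y ∈ D.Om i → Y₁ ∉ D.Om i → (Y₁ = Y.shift μ ∨ Y = Y₁.shift μ) → ¬ D.Deep i Y
  | 0, i, hi, Y, Y₁, μ, _, _, _ => D.not_deep_of_le (by omega) Y
  | n + 1, i, hi, Y, Y₁, μ, hY, hY₁, hadj => by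
    intro hdeep
    have hW : blockOf Y ∈ D.Om (i + 1) := hdeep
    have hik : i + 1 ≤ D.k := by
      by_contra hlt
      rw [D.Om_eq_empty (by omega)] at hW
      exact absurd hW (Finset.notMem_empty _)
    have hiP : i + 1 ≤ P.m + P.K := hik.trans D.hk
    have hW₁ : blockOf Y₁ ∉ D.Om (i + 1) := fun h => hY₁ (D.nested Y₁ h)
    have hne : blockOf Y₁ ≠ blockOf Y := fun h => hW₁ (h ▸ hW)
    have hadj' := blockOf_adjacent_of_ne hiP hadj hne
    -- induction hypothesis one level up: `B(Y)` is not deep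
    have hnd : ¬ D.Deep (i + 1) (blockOf Y) :=
      not_deep_of_adjacent_not_mem n (i + 1) (by omega) (blockOf Y) (blockOf Y₁) μ hW hW₁ hadj'
    have hnd₁ : ¬ D.Deep (i + 1) (blockOf Y₁) := fun h => hW₁ (D.nested _ h)
    -- the Λ_{i+1}-bond between the two blocks; its collar contains `Y₁`
    rcases hadj' with h | h
    · have hLB : D.LamBond (i + 1) ⟨blockOf Y, μ⟩ :=
        ⟨Or.inl hW, hnd, by change ¬ D.Deep (i + 1) ((blockOf Y).shift μ); rw [← h]; exact hnd₁⟩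
      exact hY₁ (hcollar i ⟨blockOf Y, μ⟩ hLB Y₁ (Or.inr (by change blockOf Y₁ = (blockOf Y).shift μ; exact h)))
    · have hLB : D.LamBond (i + 1) ⟨blockOf Y₁, μ⟩ :=
        ⟨Or.inr (by change (blockOf Y₁).shift μ ∈ D.Om (i + 1); rw [← h]; exact hW), hnd₁,
          by change ¬ D.Deep (i + 1) ((blockOf Y₁).shift μ); rw [← h]; exact hnd⟩
      exact hY₁ (hcollar i ⟨blockOf Y₁, μ⟩ hLB Y₁ (Or.inl rfl))

include hcollar in
/-- … in the plain form. [cite: Balaban1984PropagatorsII, (2.1)-(2.4) p.224] -/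
theorem lamSite_of_adjacent_not_mem {i : ℕ} {Y Y₁ : Site P i} {μ : Fin P.d} (hY : Y ∈ D.Om i) (hY₁ : Y₁ ∉ D.Om i)
    (hadj : Y₁ = Y.shift μ ∨ Y = Y₁.shift μ) : D.LamSite i Y :=
  ⟨hY, not_deep_of_adjacent_not_mem D hcollar D.k i (Nat.le_add_left _ _) Y Y₁ μ hY hY₁ hadj⟩

variable {I : (j : ℕ) → PBond P j → Prop}
  (hI₁ : ∀ (j : ℕ) (b : PBond P j), I j b → D.LamSite j b.src ∨ D.LamSite j b.tgt)

include hcollar hI₁ in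
/-- ★ **THE LEVELS OF THE TOUCHED BLOCKS OVER A FINE SITE** (collar property): if the `j`-block `Bʲ(x)` of a fine site `x` of territory `j₀` (`B^{j₀}(x) ∈ Λ_{j₀}`) is an
end-point of an index bond of level `j`, then `j ∈ {j₀ − 1, j₀, j₀ + 1}` — the inner-crossing case of p616754 `depth_cases_of_touched` (`Bʲ(x)` deep with a non-deep
lattice neighbour) forces, by the boundary lemma one level up, `B^{j+1}(x) ∈ Λ_{j+1}`, i.e. `j₀ = j + 1`.  So a fine bond is read by AT MOST THREE touched blocks.
[cite: Balaban1984PropagatorsII, (2.1)-(2.4) p.224; Balaban1988Convergent, (2.10) p.256] -/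
theorem level_of_touched {j : ℕ} {b : PBond P j} (hb : I j b) {x : Site P 0} (hx : iterBlockOf j x = b.src ∨ iterBlockOf j x = b.tgt)
    {j₀ : ℕ} (hj₀ : D.LamSite j₀ (iterBlockOf j₀ x)) : j₀ = j ∨ j₀ + 1 = j ∨ j + 1 = j₀ := by
  rcases depth_cases_of_touched D hcollar hI₁ hb hx hj₀ with h | ⟨h, -, -⟩ | ⟨h, y₁, μ, hy₁, hadj⟩
  · exact Or.inl h
  · exact Or.inr (Or.inl h)
  · refine Or.inr (Or.inr ?_)
    have hjP : j + 1 ≤ P.m + P.K := by have := D.le_of_lamSite hj₀; have := D.hk; omega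
    -- `Bʲ(x)` is deep: its block `B^{j+1}(x)` lies in `Ω_{j+1}`; the neighbour's block does not
    have hW : blockOf (iterBlockOf j x) ∈ D.Om (j + 1) := inOm_of_le_depth D hj₀ h
    have hW₁ : blockOf y₁ ∉ D.Om (j + 1) := hy₁
    have hne : blockOf y₁ ≠ blockOf (iterBlockOf j x) := fun e => hW₁ (e ▸ hW)
    have hadj₀ : y₁ = (iterBlockOf j x).shift μ ∨ iterBlockOf j x = y₁.shift μ := by
      rcases hadj with e | e
      · exact Or.inl e
      · exact Or.inr e.symm
    have hadj' := blockOf_adjacent_of_ne hjP hadj₀ hne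
    have hnd : ¬ D.Deep (j + 1) (blockOf (iterBlockOf j x)) :=
      not_deep_of_adjacent_not_mem D hcollar D.k (j + 1) (Nat.le_add_left _ _) _ _ μ hW hW₁ hadj'
    have hLam : D.LamSite (j + 1) (iterBlockOf (j + 1) x) := by
      rw [iterBlockOf_succ]; exact ⟨hW, hnd⟩
    exact (D.lamSite_iterBlockOf_unique hLam hj₀)

end Boundary

/-! ## §3  The column letter of a gauge map with the dichotomy property -/

section Column

variable (D : Domains P)
  (hcollar : ∀ (i : ℕ) (e : PBond P (i + 1)), D.LamBond (i + 1) e → ∀ z : Site P i, (blockOf z = e.src ∨ blockOf z = e.tgt) → z ∈ D.Om i)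
  {I : (j : ℕ) → PBond P j → Prop}
  (hI₁ : ∀ (j : ℕ) (b : PBond P j), I j b → D.LamSite j b.src ∨ D.LamSite j b.tgt)

include hcollar hI₁ in
/-- ★★★ **THE COLUMN LETTER OF THE MULTI-LEVEL GAUGE MAP.**  Let `T` be ANY map from fine bond fields to fine gauge functions with the DICHOTOMY property of p617458
(`exists_linear_gauge_dIterL_one_eq_zero_of_bondAvgIter_eq_zero`, 6th conjunct): for every comb family `Λ` and every `Z`, `x`, either `(TZ)(x) = 0` or
`(TZ)(x) = Λ_jZ(y)` for an end-point `y` of an index bond of level `j` centred at `x`.  Then for every field `Z` SUPPORTED ON ONE FINE BOND `b′` the column of `T` reads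
`(TZ)(x) = c(x)•Z(b′)` with REAL coefficients of total mass `Σ_x |c(x)| ≤ 6(d+2)L` (`d ≥ 2`): only the touched blocks CONTAINING `b′₋` contribute (locality), they sit at
the levels `j₀ − 1, j₀, j₀ + 1` of the territory `j₀` of `b′₋` (boundary lemma), and each contributes at most `2(d+2)L` (unit-column letter of `Λ_j`).  NO `L^k`, NO `N`.
[cite: Balaban1985Variational, (44)-(47) p.285, (98) p.292; Balaban1985Averaging, (62) p.28; Balaban1984PropagatorsI, (1.18) p.20; Balaban1984PropagatorsII, (2.1)-(2.4) p.224] -/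
theorem exists_column_of_dichotomy (hd : 2 ≤ P.d)
    (T : (PBond P 0 → Matrix (Fin N) (Fin N) ℂ) → Site P 0 → Matrix (Fin N) (Fin N) ℂ)
    (hT : ∀ (Λ : (i : ℕ) → (PBond P 0 → Matrix (Fin N) (Fin N) ℂ) → Site P i → Matrix (Fin N) (Fin N) ℂ),
      (∀ Y y, Λ 0 Y y = 0) →
      (∀ (i : ℕ) (Y : PBond P 0 → Matrix (Fin N) (Fin N) ℂ) (y : Site P (i + 1)),
        Λ (i + 1) Y y = (P.L ^ i : ℕ) • combMean (bondAvgIter i Y) y + Λ i Y (emb y)) →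
      ∀ (Z : PBond P 0 → Matrix (Fin N) (Fin N) ℂ) (x : Site P 0), T Z x = 0 ∨
        ∃ (j : ℕ) (b : PBond P j) (y : Site P j), I j b ∧ (y = b.src ∨ y = b.tgt) ∧ embIter j y = x ∧ T Z x = Λ j Z y)
    (b' : PBond P 0) (Z : PBond P 0 → Matrix (Fin N) (Fin N) ℂ) (hZ : ∀ b, b ≠ b' → Z b = 0) :
    ∃ c : Site P 0 → ℝ, (∀ x, T Z x = c x • Z b') ∧ ∑ x, |c x| ≤ 6 * (((P.d + 2) * P.L : ℕ) : ℝ) := by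
  classical
  obtain ⟨Λ, hΛ0, hΛs⟩ := exists_combFamily (P := P) (n := Fin N)
  -- `Z = f • Z(b′)` with `f` the indicator of `b′`
  let f : PBond P 0 → ℝ := fun b => if b = b' then 1 else 0
  have hf0 : ∀ b, 0 ≤ f b := fun b => by simp only [f]; split_ifs <;> norm_num
  have hf1 : ∑ b, f b ≤ 1 := by simp [f]
  have hZf : Z = fun b => f b • Z b' := by
    funext b
    by_cases hb : b = b'
    · subst hb; simp [f]
    · simp [f, hb, hZ b hb]
  -- the territory `j₀` of `x₀ = b′₋` and the three candidate centres
  obtain ⟨j₀, -, hj₀⟩ := D.exists_lamSite_iterBlockOf b'.src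
  let S : Finset (Site P 0) := ({j₀ - 1, j₀, j₀ + 1} : Finset ℕ).image fun j => embIter j (iterBlockOf j b'.src)
  have hS : S.card ≤ 3 := Finset.card_image_le.trans Finset.card_le_three
  set K₁ : ℝ := 2 * (((P.d + 2) * P.L : ℕ) : ℝ) with hK₁
  have hK₁0 : 0 ≤ K₁ := by positivity
  -- pointwise: a real coefficient, bounded by `K₁` on `S` and `0` off `S`
  have hpt : ∀ x, ∃ r : ℝ, T Z x = r • Z b' ∧ |r| ≤ if x ∈ S then K₁ else 0 := by
    intro x
    have hif : (0 : ℝ) ≤ if x ∈ S then K₁ else 0 := by split_ifs <;> [exact hK₁0; exact le_rfl]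
    rcases hT Λ hΛ0 hΛs Z x with h0 | ⟨j, b, y, hb, hyb, hyx, hTeq⟩
    · exact ⟨0, by rw [h0, zero_smul], by rw [abs_zero]; exact hif⟩
    have hjP : j ≤ P.m + P.K := by
      rcases hI₁ j b hb with h | h <;> exact (D.le_of_lamSite h).trans D.hk
    by_cases hblk : iterBlockOf j b'.src = y
    · -- a touched block over `b′₋`: level `j ∈ {j₀ − 1, j₀, j₀ + 1}`, centre in `S`
      have hlev := level_of_touched D hcollar hI₁ hb (x := b'.src) (by rw [hblk]; exact hyb) hj₀
      have hxS : x ∈ S := by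
        refine Finset.mem_image.mpr ⟨j, ?_, by rw [hblk, hyx]⟩
        simp only [Finset.mem_insert, Finset.mem_singleton]
        omega
      obtain ⟨r, hr, hrb⟩ := exists_combFamily_smul_const' Λ hΛ0 hΛs hd f hf0 hf1 (Z b') hjP y
      refine ⟨r, ?_, by rw [if_pos hxS]; exact hrb⟩
      rw [hTeq]
      conv_lhs => rw [hZf]
      exact hr
    · -- the block misses `b′`: the comb functional vanishes
      have hzero : Λ j Z y = 0 :=
        combFamily_eq_zero_of_vanish Λ hΛ0 hΛs j hjP Z y fun b h1 _ => hZ b fun hbb => hblk (hbb ▸ h1)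
      exact ⟨0, by rw [hTeq, hzero, zero_smul], by rw [abs_zero]; exact hif⟩
  choose c hc hcb using hpt
  refine ⟨c, hc, ?_⟩
  calc ∑ x, |c x| ≤ ∑ x, (if x ∈ S then K₁ else 0) := Finset.sum_le_sum fun x _ => hcb x
    _ = ∑ x ∈ S, K₁ := by rw [← Finset.sum_filter]; congr 1; ext x; simp
    _ = S.card * K₁ := by rw [Finset.sum_const, nsmul_eq_mul]
    _ ≤ 3 * K₁ := mul_le_mul_of_nonneg_right (by exact_mod_cast hS) hK₁0
    _ = 6 * (((P.d + 2) * P.L : ℕ) : ℝ) := by rw [hK₁]; ring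

end Column

end Summit.QuantumFields.YangMills.Theorems.K0Stub1CombColumnLetter

end
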